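import Summits.Ventures.WeilGRH.UniformConductorFloorPrincipal
import Summits.Ventures.WeilGRH.UniformConductorFloorPrincipalDominates
import Summits.Ventures.WeilGRH.UniformConductorFloorJointFloorsLog8
import Summits.Ventures.WeilGRH.UniformConductorFloorCoprimeFloorsLog8
import HarnessLib

/-!
# GRH arm (rh-explicit, venture WeilGRH): the principal-character dichotomy at the window `(log 8)/2` —
  prime moduli `p ≥ 97` exactly, and the all-moduli decision modulo seven composite moduli

Cell `rh-explicit`, WEIL TRACK — GRH ARM (weil-grh-1, gen9).  The `t = 1` picture of gen8
(`UniformConductorFloorPrincipal.lean`, `UniformConductorFloorOneIff.lean`, `UniformConductorFloorOneComplete.lean`: the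
all-characters statement `U_1(q)` = «`∀ χ` mod `q`, `WeilPositivityOnChar χ 1`» holds iff `q ∉ F`, `F` an explicit
42-element set; for a prime `p` iff `p ≥ 79`) is carried to the next rung of the arm's ladder, the window
`[-(log 8)/2, (log 8)/2]` (the largest window whose prime powers are still `2, 3, 4, 5, 7`):

* NEGATIVE side (this file, §1–§4).  The witness is again Yoshida's FLAT window `χ_0 = (2a)^{-1/2}𝟙_{[-a,a]}`,
  `a = (log 8)/2`: its twisted window form for a real even character is the single Gram entry
  `twistedGramCoeff χ a 0 0 = log q − F_χ(a)`, refuting `WeilPositivityOnChar χ a` when negative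
  (`UniformConductorFloorPrincipal.not_weilPositivityOnChar_of_checkFlat`, gen8, generic in the window).  NEW: the
  window constants and the mode-`0` special-value record at `a = (log 8)/2` are COMPUTED IN THE KERNEL from `π`
  (Machin) and `log 8` by weil-2's certified evaluator (`Yoshida1992.Encl.consts` / `Encl.idxRec`, inclusion theorems
  `constsValid_of_consts` / `idxValid_of_idxRec`) — no special-value table at this window is needed or posited
  (`not_weilPositivityOnChar_halfLog_of_flatCheck`, sound for every window `a = (log b)/2`).  Flat thresholds
  `e^{F_{χ₀}((log 8)/2)}` by coprimality pattern of `q` in `{2, 3, 5, 7}` (float, 30 digits; certified integer parts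
  in the kernel fact `flatCheck_log8half`): coprime `90.096` · only `2 ∣ q`: `37.20` · `3`: `49.53` · `5`: `65.07` ·
  `7`: `81.98` · `{2,3}`: `20.45` · `{2,5}`: `26.87` · `{2,7}`: `33.85` · `{3,5}`: `35.77` · `{3,7}`: `45.06` ·
  `{5,7}`: `59.21`.  Hence the principal character fails on the explicit 50-element set
  `F₈ = {2,…,23, 25,…,29, 31,…,35, 37, 39, 41, 43, 47, 49, 53, 55, 59, 61, 65, 67, 71, 73, 77, 79, 83, 89} ⊇ F`
  (`not_weilPositivityOnChar_log8half_principal`), in particular for EVERY PRIME `p ≤ 89`.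
* POSITIVE side (gen6/gen7, imported): every `χ` mod `q ≥ 97` (`UniformConductorFloorJointFloorsLog8`), `2 ∣ q ≥ 42`,
  `3 ∣ q ≥ 54`, `6 ∣ q ≥ 24` (`UniformConductorFloorCoprimeFloorsLog8`).

**THEOREMS.** `forall_weilPositivityOnChar_log8half_iff_of_prime`: for a PRIME `p`, every Dirichlet character mod `p`
is Weil-positive on `[-(log 8)/2, (log 8)/2]` iff `p ≥ 97` — EXACT (flat threshold `90.096 > 89`, floor `97`, no prime in
between; at `t = 1` the threshold was `79`).  `forall_weilPositivityOnChar_log8half_iff`: for every `q ≥ 2` outside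
`U₈ = {38, 40, 45, 51, 85, 91, 95}`, `U_{(log 8)/2}(q) ↔ q ∉ F₈`.  The seven moduli of `U₈` lie between the flat
threshold of their pattern and the typed divisibility floors (even Galerkin sections, 24 modes: pattern `{2}` `37.996`,
`{3}` `50.09`, `{7}` `83.64`; level-`5`/`7`/`10`/`15` certificates at this window are not yet typed).
By `WeilPositivityOnChar.of_principal` (gen8) each statement is a statement about the principal character alone.

Honest scope: as in gen8 — principal characters are not the object of GRH; the content is the exact shape of the
arm's uniform-in-`χ` statements at the rung `(log 8)/2`.  RH/GRH-free; standard axioms; no named facts.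

## References

* H. Yoshida, *On Hermitian forms attached to zeta functions*, Adv. Stud. Pure Math. 21 (1992) 281–325, §3, §5 (5.15)
  p. 301. [Yoshida1992HermitianForms]
* A. Weil, *Sur les "formules explicites" de la théorie des nombres premiers* (1952), (11) pp. 261–262.
  [Weil1952FormulesExplicites]
* R. E. Moore, *Interval Analysis* (1966), Ch. 3. [Moore1966]
(Re-landed unchanged by weil-grh-1 gen10 to re-trigger the hub build; declarations byte-identical.)
-/

set_option autoImplicit false

noncomputable section

open Real Complex Finset
open scoped BigOperators ArithmeticFunction.vonMangoldt ComplexConjugate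

namespace Summit.Ventures.WeilGRH

open Literature.NumberTheory.LFunctions Literature.NumberTheory.LFunctions.Yoshida1992
open Literature.NumberTheory.LFunctions.Yoshida1992.Encl
open Literature.Analysis.SpecialFunctions Literature.Analysis.ValidatedNumerics.NumericsMP
open TwistedEncl

namespace UniformFloor

variable {q : ℕ}

/-! ## §1 A table-free flat-window check for the windows `a = (log b)/2` -/

/-- **Soundness of the table-free flat-window check at a half-log window.**  For evaluator parameters `prm`, a window
base `b ≥ 2` (`a = (log b)/2`) with certified prime data `ks`, and a list of patterns `(Q, εs)`: the closed term computes
`π` (Machin), `a = (log b)/2`, the window constants (`Encl.consts`) and the mode-`0` record (`Encl.idxRec`) and, for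
each pattern, the box of the flat Gram entry `twistedGramCoeff χ a 0 0` with prime signs `εs` and `log q ∈ [0, log Q]`;
if it returns `some true`, then every real even character `χ` mod `q ≠ 1`, `q ≤ Q`, with `Re χ(k_i) = ε_i` on the listed
prime powers FAILS `WeilPositivityOnChar χ ((log b)/2)`.
[cite: Yoshida1992HermitianForms, §5 (5.15) p. 301; Moore1966, Ch. 3 (interval arithmetic: inclusion property)] -/
theorem not_weilPositivityOnChar_halfLog_of_flatCheck {prm : Params} (hS : 0 < prm.S) (hK : 1 ≤ prm.Kexp)
    {b Kpi prec : ℕ} (hb : 1 < b) {ks : List PrimeLen} (hks : checkPrimeDataHalfLog b ks = true)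
    {pats : List (ℕ × List ℤ)}
    (h : ((MI.piMachin prm.S Kpi).bind fun P ↦ (MI.logNat2 prm.S prm.Kser b).bind fun L ↦
          (consts prm P (L.divNat 2) ks).bind fun C ↦ (idxRec prm C 0).map fun R ↦
            pats.all fun QE ↦ (MI.logNat prm.S prec QE.1).elim false fun B ↦
              decide ((twistedGramBox prm.S C QE.2 ⟨0, B.hi⟩ R R 0 0).hi < 0)) = some true)
    {Q : ℕ} {εs : List ℤ} (hmem : (Q, εs) ∈ pats) (hq : q ≠ 1) (hqQ : q ≤ Q) (χ : DirichletCharacter ℂ q)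
    (hreal : ∀ n : ℕ, conj (χ (n : ZMod q)) = χ (n : ZMod q)) (heven : charParity χ = 0)
    (hε : ∀ i < ks.length, (χ (((ks.getD i default).val : ℕ) : ZMod q)).re = ((εs.getD i 0 : ℤ) : ℝ)) :
    ¬ WeilPositivityOnChar χ (Real.log b / 2) := by
  cases hP : MI.piMachin prm.S Kpi with
  | none => simp [hP] at h
  | some P =>
  cases hL : MI.logNat2 prm.S prm.Kser b with
  | none => simp [hP, hL] at h
  | some L =>
  cases hC : consts prm P (L.divNat 2) ks with
  | none => simp [hP, hL, hC] at h
  | some C =>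
  cases hR : idxRec prm C 0 with
  | none => simp [hP, hL, hC, hR] at h
  | some R =>
  simp only [hP, hL, hC, hR, Option.bind_some, Option.map_some, Option.some.injEq, List.all_eq_true] at h
  have hb1 : (1 : ℝ) < b := by exact_mod_cast hb
  have ha0 : (0 : ℝ) < Real.log b / 2 := div_pos (Real.log_pos hb1) two_pos
  have ha : MI.mem prm.S (Real.log b / 2) (L.divNat 2) := by
    have := MI.mem_divNat (MI.mem_logNat2 hS hL) (n := 2) (by norm_num)
    exact mem_of_eq this (by push_cast; ring)
  have hCv : ConstsValid prm.S (Real.log b / 2) ks C := constsValid_of_consts hS hK (MI.mem_piMachin hS hP) ha hC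
  obtain ⟨hRo, hRd⟩ := idxValid_of_idxRec hS ha0 hCv hR
  have hpat := h (Q, εs) hmem
  exact not_weilPositivityOnChar_of_checkFlat hS ha0 (primeData_of_checkHalfLog hks) hCv (by simpa using hRo)
    (by simpa using hRd) hpat hq hqQ χ hreal heven hε

/-! ## §2 The window `(log 8)/2`: kernel facts -/

/-- kernel: the prime powers of the window `(log 8)/2` are `2, 3, 4, 5, 7` (`k < 8`). [cite: Yoshida1992HermitianForms, §5 (5.15) p. 301] -/
theorem primeData_log8half_check : checkPrimeDataHalfLog 8 [⟨2, 1⟩, ⟨3, 1⟩, ⟨2, 2⟩, ⟨5, 1⟩, ⟨7, 1⟩] = true := by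
  decide +kernel

/-- kernel: **the eleven flat-window refutations at `(log 8)/2`** (scale `2^80`; `π` by Machin with 70 terms; series
length 96, 8 halvings, 24 exponential-table terms, Stirling shift 60).  Pattern `(Q, [ε₂, ε₃, ε₄, ε₅, ε₇])`: the flat
entry with prime signs `ε` is `< 0` for every `q ≤ Q`; `Q` is the integer part of the flat threshold `e^{F}`:
coprime `90` (`F = 4.500877`, `e^F = 90.096`; margin at `90`: `−0.00107`), only `2 ∣ q`: `37`, `3`: `49`, `5`: `65`,
`7`: `81`, `{2,3}`: `20`, `{2,5}`: `26`, `{2,7}`: `33`, `{3,5}`: `35`, `{3,7}`: `45`, `{5,7}`: `59`.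
[cite: Moore1966, Ch. 3 (interval arithmetic: inclusion property)] -/
theorem flatCheck_log8half :
    ((MI.piMachin (⟨2 ^ 80, 96, 8, 24, 60⟩ : Params).S 70).bind fun P ↦
      (MI.logNat2 (⟨2 ^ 80, 96, 8, 24, 60⟩ : Params).S (⟨2 ^ 80, 96, 8, 24, 60⟩ : Params).Kser 8).bind fun L ↦
      (consts ⟨2 ^ 80, 96, 8, 24, 60⟩ P (L.divNat 2) [⟨2, 1⟩, ⟨3, 1⟩, ⟨2, 2⟩, ⟨5, 1⟩, ⟨7, 1⟩]).bind fun C ↦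
      (idxRec ⟨2 ^ 80, 96, 8, 24, 60⟩ C 0).map fun R ↦
        [(90, [1, 1, 1, 1, 1]), (37, [0, 1, 0, 1, 1]), (49, [1, 0, 1, 1, 1]), (65, [1, 1, 1, 0, 1]), (81, [1, 1, 1, 1, 0]),
          (20, [0, 0, 0, 1, 1]), (26, [0, 1, 0, 0, 1]), (33, [0, 1, 0, 1, 0]), (35, [1, 0, 1, 0, 1]), (45, [1, 0, 1, 1, 0]),
          (59, [1, 1, 1, 0, 0])].all fun QE ↦
          (MI.logNat (⟨2 ^ 80, 96, 8, 24, 60⟩ : Params).S 96 QE.1).elim false fun B ↦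
            decide ((twistedGramBox (⟨2 ^ 80, 96, 8, 24, 60⟩ : Params).S C QE.2 ⟨0, B.hi⟩ R R 0 0).hi < 0)) =
      some true := by
  decide +kernel

/-! ## §3 The principal character at `(log 8)/2` -/

/-- `(4, q) = 1 ↔ (2, q) = 1`. [folklore] -/
private theorem coprime_four_iff' : (4 : ℕ).Coprime q ↔ (2 : ℕ).Coprime q := by
  rw [show (4 : ℕ) = 2 ^ 2 by norm_num]
  exact Nat.coprime_pow_left_iff (by norm_num) 2 q

/-- The prime signs of the principal character on `2, 3, 4, 5, 7`: `Re χ₀(k) = 𝟙[(k, q) = 1]`. [folklore] -/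
theorem principal_signs_2357 :
    ∀ i < ([⟨2, 1⟩, ⟨3, 1⟩, ⟨2, 2⟩, ⟨5, 1⟩, ⟨7, 1⟩] : List PrimeLen).length,
      ((1 : DirichletCharacter ℂ q) (((([⟨2, 1⟩, ⟨3, 1⟩, ⟨2, 2⟩, ⟨5, 1⟩, ⟨7, 1⟩] : List PrimeLen).getD i default).val
        : ℕ) : ZMod q)).re =
      (([(if (2 : ℕ).Coprime q then (1 : ℤ) else 0), (if (3 : ℕ).Coprime q then (1 : ℤ) else 0),
        (if (2 : ℕ).Coprime q then (1 : ℤ) else 0), (if (5 : ℕ).Coprime q then (1 : ℤ) else 0),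
        (if (7 : ℕ).Coprime q then (1 : ℤ) else 0)].getD i 0 : ℤ) : ℝ) := by
  intro i hi
  have hi5 : i < 5 := by simpa using hi
  interval_cases i
  · show ((1 : DirichletCharacter ℂ q) ((2 ^ 1 : ℕ) : ZMod q)).re = (((if (2 : ℕ).Coprime q then (1 : ℤ) else 0) : ℤ) : ℝ)
    rw [pow_one, re_one_apply_natCast]
    split_ifs <;> simp
  · show ((1 : DirichletCharacter ℂ q) ((3 ^ 1 : ℕ) : ZMod q)).re = (((if (3 : ℕ).Coprime q then (1 : ℤ) else 0) : ℤ) : ℝ)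
    rw [pow_one, re_one_apply_natCast]
    split_ifs <;> simp
  · show ((1 : DirichletCharacter ℂ q) ((2 ^ 2 : ℕ) : ZMod q)).re = (((if (2 : ℕ).Coprime q then (1 : ℤ) else 0) : ℤ) : ℝ)
    rw [show (2 ^ 2 : ℕ) = 4 from rfl, re_one_apply_natCast, if_congr coprime_four_iff' rfl rfl]
    split_ifs <;> simp
  · show ((1 : DirichletCharacter ℂ q) ((5 ^ 1 : ℕ) : ZMod q)).re = (((if (5 : ℕ).Coprime q then (1 : ℤ) else 0) : ℤ) : ℝ)
    rw [pow_one, re_one_apply_natCast]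
    split_ifs <;> simp
  · show ((1 : DirichletCharacter ℂ q) ((7 ^ 1 : ℕ) : ZMod q)).re = (((if (7 : ℕ).Coprime q then (1 : ℤ) else 0) : ℤ) : ℝ)
    rw [pow_one, re_one_apply_natCast]
    split_ifs <;> simp

/-- **The door at `(log 8)/2` for principal characters.**  A pattern `(Q, [e₂, e₃, e₂, e₅, e₇])` of the kernel fact
`flatCheck_log8half` with `e_p = 𝟙[(p, q) = 1]` refutes `WeilPositivityOnChar 1 ((log 8)/2)` for every modulus
`1 ≠ q ≤ Q` with that coprimality pattern. [cite: Yoshida1992HermitianForms, §5 (5.15) p. 301] -/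
theorem not_weilPositivityOnChar_log8half_principal_of_pattern {Q : ℕ} {e2 e3 e5 e7 : ℤ}
    (hmem : (Q, [e2, e3, e2, e5, e7]) ∈ [(90, [1, 1, 1, 1, 1]), (37, [0, 1, 0, 1, 1]), (49, [1, 0, 1, 1, 1]),
      (65, [1, 1, 1, 0, 1]), (81, [1, 1, 1, 1, 0]), (20, [0, 0, 0, 1, 1]), (26, [0, 1, 0, 0, 1]), (33, [0, 1, 0, 1, 0]),
      (35, [1, 0, 1, 0, 1]), (45, [1, 0, 1, 1, 0]), (59, [1, 1, 1, 0, 0])])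
    (hq : q ≠ 1) (hqQ : q ≤ Q)
    (h2 : (if (2 : ℕ).Coprime q then (1 : ℤ) else 0) = e2) (h3 : (if (3 : ℕ).Coprime q then (1 : ℤ) else 0) = e3)
    (h5 : (if (5 : ℕ).Coprime q then (1 : ℤ) else 0) = e5) (h7 : (if (7 : ℕ).Coprime q then (1 : ℤ) else 0) = e7) :
    ¬ WeilPositivityOnChar (1 : DirichletCharacter ℂ q) (Real.log 8 / 2) := by
  subst h2 h3 h5 h7
  exact not_weilPositivityOnChar_halfLog_of_flatCheck (prm := ⟨2 ^ 80, 96, 8, 24, 60⟩) (by norm_num) (by norm_num)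
    (by norm_num) primeData_log8half_check flatCheck_log8half hmem hq hqQ (1 : DirichletCharacter ℂ q)
    (fun n ↦ conj_one_apply _) charParity_one principal_signs_2357

/-! ## §4 The explicit set `F₈` of failing moduli -/

set_option maxRecDepth 100000 in
/-- The pattern dispatch of `F₈`: every member has one of the eleven certified coprimality patterns with the matching
bound. [folklore] -/
theorem principalFailuresLog8_dispatch : ∀ q ∈ ({2, 3, 4, 5, 6, 7, 8, 9, 10, 11, 12, 13, 14, 15, 16, 17, 18, 19, 20, 21,
      22, 23, 25, 26, 27, 28, 29, 31, 32, 33, 34, 35, 37, 39, 41, 43, 47, 49, 53, 55, 59, 61, 65, 67, 71, 73, 77, 79, 83,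
      89} : Finset ℕ),
    ((2 : ℕ).Coprime q ∧ (3 : ℕ).Coprime q ∧ (5 : ℕ).Coprime q ∧ (7 : ℕ).Coprime q ∧ q ≤ 90) ∨
    (¬ (2 : ℕ).Coprime q ∧ (3 : ℕ).Coprime q ∧ (5 : ℕ).Coprime q ∧ (7 : ℕ).Coprime q ∧ q ≤ 37) ∨
    ((2 : ℕ).Coprime q ∧ ¬ (3 : ℕ).Coprime q ∧ (5 : ℕ).Coprime q ∧ (7 : ℕ).Coprime q ∧ q ≤ 49) ∨
    ((2 : ℕ).Coprime q ∧ (3 : ℕ).Coprime q ∧ ¬ (5 : ℕ).Coprime q ∧ (7 : ℕ).Coprime q ∧ q ≤ 65) ∨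
    ((2 : ℕ).Coprime q ∧ (3 : ℕ).Coprime q ∧ (5 : ℕ).Coprime q ∧ ¬ (7 : ℕ).Coprime q ∧ q ≤ 81) ∨
    (¬ (2 : ℕ).Coprime q ∧ ¬ (3 : ℕ).Coprime q ∧ (5 : ℕ).Coprime q ∧ (7 : ℕ).Coprime q ∧ q ≤ 20) ∨
    (¬ (2 : ℕ).Coprime q ∧ (3 : ℕ).Coprime q ∧ ¬ (5 : ℕ).Coprime q ∧ (7 : ℕ).Coprime q ∧ q ≤ 26) ∨
    (¬ (2 : ℕ).Coprime q ∧ (3 : ℕ).Coprime q ∧ (5 : ℕ).Coprime q ∧ ¬ (7 : ℕ).Coprime q ∧ q ≤ 33) ∨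
    ((2 : ℕ).Coprime q ∧ ¬ (3 : ℕ).Coprime q ∧ ¬ (5 : ℕ).Coprime q ∧ (7 : ℕ).Coprime q ∧ q ≤ 35) ∨
    ((2 : ℕ).Coprime q ∧ ¬ (3 : ℕ).Coprime q ∧ (5 : ℕ).Coprime q ∧ ¬ (7 : ℕ).Coprime q ∧ q ≤ 45) ∨
    ((2 : ℕ).Coprime q ∧ (3 : ℕ).Coprime q ∧ ¬ (5 : ℕ).Coprime q ∧ ¬ (7 : ℕ).Coprime q ∧ q ≤ 59) := by
  decide +kernel

set_option maxRecDepth 100000 in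
/-- Every modulus `n < 97` outside `F₈` is `0`, `1` or composite (explicit divisor) — so every prime `p ≤ 89` lies in
`F₈` (and `97` is the next prime). [folklore] -/
theorem principalFailuresLog8_complement : ∀ n < 97,
    n ∉ ({2, 3, 4, 5, 6, 7, 8, 9, 10, 11, 12, 13, 14, 15, 16, 17, 18, 19, 20, 21, 22, 23, 25, 26, 27, 28, 29, 31, 32, 33,
      34, 35, 37, 39, 41, 43, 47, 49, 53, 55, 59, 61, 65, 67, 71, 73, 77, 79, 83, 89} : Finset ℕ) →
    n < 2 ∨ ∃ d < n, 2 ≤ d ∧ d ∣ n := by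
  decide +kernel

/-- ★ **The principal character of every modulus in `F₈` fails Weil positivity on `[-(log 8)/2, (log 8)/2]`.**  The
witness is the flat window; the obstruction value is `twistedGramCoeff 1 ((log 8)/2) 0 0 = log q − F_{χ₀}((log 8)/2) < 0`.
`F₈ ⊇ F` has the eight new members `18, 32, 34, 65, 77, 79, 83, 89`.
[cite: Yoshida1992HermitianForms, §5 (5.15) p. 301; Weil1952FormulesExplicites, (11) pp. 261–262] -/
theorem not_weilPositivityOnChar_log8half_principal
    (hq : q ∈ ({2, 3, 4, 5, 6, 7, 8, 9, 10, 11, 12, 13, 14, 15, 16, 17, 18, 19, 20, 21, 22, 23, 25, 26, 27, 28, 29, 31, 32,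
      33, 34, 35, 37, 39, 41, 43, 47, 49, 53, 55, 59, 61, 65, 67, 71, 73, 77, 79, 83, 89} : Finset ℕ)) :
    ¬ WeilPositivityOnChar (1 : DirichletCharacter ℂ q) (Real.log 8 / 2) := by
  have hq1 : q ≠ 1 := by
    rintro rfl
    simp only [Finset.mem_insert, Finset.mem_singleton] at hq
    omega
  rcases principalFailuresLog8_dispatch q hq with ⟨h2, h3, h5, h7, hle⟩ | ⟨h2, h3, h5, h7, hle⟩ | ⟨h2, h3, h5, h7, hle⟩ |
      ⟨h2, h3, h5, h7, hle⟩ | ⟨h2, h3, h5, h7, hle⟩ | ⟨h2, h3, h5, h7, hle⟩ | ⟨h2, h3, h5, h7, hle⟩ | ⟨h2, h3, h5, h7, hle⟩ |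
      ⟨h2, h3, h5, h7, hle⟩ | ⟨h2, h3, h5, h7, hle⟩ | ⟨h2, h3, h5, h7, hle⟩
  · exact not_weilPositivityOnChar_log8half_principal_of_pattern (Q := 90) (by simp) hq1 hle
      (if_pos h2) (if_pos h3) (if_pos h5) (if_pos h7)
  · exact not_weilPositivityOnChar_log8half_principal_of_pattern (Q := 37) (by simp) hq1 hle
      (if_neg h2) (if_pos h3) (if_pos h5) (if_pos h7)
  · exact not_weilPositivityOnChar_log8half_principal_of_pattern (Q := 49) (by simp) hq1 hle
      (if_pos h2) (if_neg h3) (if_pos h5) (if_pos h7)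
  · exact not_weilPositivityOnChar_log8half_principal_of_pattern (Q := 65) (by simp) hq1 hle
      (if_pos h2) (if_pos h3) (if_neg h5) (if_pos h7)
  · exact not_weilPositivityOnChar_log8half_principal_of_pattern (Q := 81) (by simp) hq1 hle
      (if_pos h2) (if_pos h3) (if_pos h5) (if_neg h7)
  · exact not_weilPositivityOnChar_log8half_principal_of_pattern (Q := 20) (by simp) hq1 hle
      (if_neg h2) (if_neg h3) (if_pos h5) (if_pos h7)
  · exact not_weilPositivityOnChar_log8half_principal_of_pattern (Q := 26) (by simp) hq1 hle
      (if_neg h2) (if_pos h3) (if_neg h5) (if_pos h7)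
  · exact not_weilPositivityOnChar_log8half_principal_of_pattern (Q := 33) (by simp) hq1 hle
      (if_neg h2) (if_pos h3) (if_pos h5) (if_neg h7)
  · exact not_weilPositivityOnChar_log8half_principal_of_pattern (Q := 35) (by simp) hq1 hle
      (if_pos h2) (if_neg h3) (if_neg h5) (if_pos h7)
  · exact not_weilPositivityOnChar_log8half_principal_of_pattern (Q := 45) (by simp) hq1 hle
      (if_pos h2) (if_neg h3) (if_pos h5) (if_neg h7)
  · exact not_weilPositivityOnChar_log8half_principal_of_pattern (Q := 59) (by simp) hq1 hle
      (if_pos h2) (if_pos h3) (if_neg h5) (if_neg h7)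

/-- **Every principal character modulo a number `1 ≠ q ≤ 90` coprime to `210` fails at `(log 8)/2`** (flat threshold
`90.096`). [cite: Weil1952FormulesExplicites, (11) pp. 261–262] -/
theorem not_weilPositivityOnChar_log8half_principal_of_coprime (hq1 : q ≠ 1) (hq : q ≤ 90) (hcop : q.Coprime 210) :
    ¬ WeilPositivityOnChar (1 : DirichletCharacter ℂ q) (Real.log 8 / 2) := by
  have h2 : (2 : ℕ).Coprime q := Nat.Coprime.symm (Nat.Coprime.coprime_dvd_right (by norm_num) hcop)
  have h3 : (3 : ℕ).Coprime q := Nat.Coprime.symm (Nat.Coprime.coprime_dvd_right (by norm_num) hcop)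
  have h5 : (5 : ℕ).Coprime q := Nat.Coprime.symm (Nat.Coprime.coprime_dvd_right (by norm_num) hcop)
  have h7 : (7 : ℕ).Coprime q := Nat.Coprime.symm (Nat.Coprime.coprime_dvd_right (by norm_num) hcop)
  exact not_weilPositivityOnChar_log8half_principal_of_pattern (Q := 90) (by simp) hq1 hq
    (if_pos h2) (if_pos h3) (if_pos h5) (if_pos h7)

/-- ★ **For every prime `p ≤ 89` the principal character mod `p` fails Weil positivity on `[-(log 8)/2, (log 8)/2]`**
(at `t = 1` the failures were the primes `p ≤ 73`). [cite: Weil1952FormulesExplicites, (11) pp. 261–262] -/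
theorem not_weilPositivityOnChar_log8half_principal_of_prime_le (hp : q.Prime) (hq : q ≤ 89) :
    ¬ WeilPositivityOnChar (1 : DirichletCharacter ℂ q) (Real.log 8 / 2) := by
  refine not_weilPositivityOnChar_log8half_principal ?_
  by_contra hmem
  rcases principalFailuresLog8_complement q (by omega) hmem with h | ⟨d, hdq, hd2, hdvd⟩
  · exact absurd hp.two_le (by omega)
  · rcases (Nat.dvd_prime hp).1 hdvd with rfl | rfl <;> omega

/-! ## §5 Prime moduli: the exact dichotomy `p ≥ 97` -/

/-- ★★ **PRIME MODULI at `(log 8)/2`: the exact dichotomy.**  For a prime `p`, every Dirichlet character mod `p` is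
Weil-positive on `[-(log 8)/2, (log 8)/2]` if and only if `p ≥ 97` (flat threshold `90.096 > 89`, uniform floor `97`, no
prime in between). [cite: Weil1952FormulesExplicites, (11) pp. 261–262 and the «lemme» p. 262] -/
theorem forall_weilPositivityOnChar_log8half_iff_of_prime (hp : q.Prime) :
    (∀ χ : DirichletCharacter ℂ q, WeilPositivityOnChar χ (Real.log 8 / 2)) ↔ 97 ≤ q := by
  constructor
  · intro h
    by_contra hlt
    have h89 : q ≤ 89 := by
      by_contra h'
      have h90 : 90 ≤ q := by omega
      have h96 : q ≤ 96 := by omega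
      interval_cases q <;> exact absurd hp (by norm_num)
    exact not_weilPositivityOnChar_log8half_principal_of_prime_le hp h89 (h 1)
  · intro h97 χ
    exact weilPositivityOnChar_log8half_of_ge_97 h97 χ

/-- **Below `97` a prime modulus always carries a character failing on `[-(log 8)/2, (log 8)/2]`** (the principal one);
from `97` on, none. [cite: Weil1952FormulesExplicites, (11) pp. 261–262] -/
theorem exists_not_weilPositivityOnChar_log8half_iff_of_prime (hp : q.Prime) :
    (∃ χ : DirichletCharacter ℂ q, ¬ WeilPositivityOnChar χ (Real.log 8 / 2)) ↔ q ≤ 89 := by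
  have h := forall_weilPositivityOnChar_log8half_iff_of_prime hp
  constructor
  · rintro ⟨χ, hχ⟩
    by_contra h89
    have h97 : 97 ≤ q := by
      by_contra h'
      have h90 : 90 ≤ q := by omega
      have h96 : q ≤ 96 := by omega
      interval_cases q <;> exact absurd hp (by norm_num)
    exact hχ (h.2 h97 χ)
  · intro h89
    exact ⟨1, not_weilPositivityOnChar_log8half_principal_of_prime_le hp h89⟩

/-- … and `89` is sharp: some character mod `89` fails at `(log 8)/2` (while every character mod `89` is Weil-positive
on `[-1, 1]`, `UniformConductorFloorOneIff`). [cite: Weil1952FormulesExplicites, (11) pp. 261–262] -/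
theorem exists_not_weilPositivityOnChar_log8half_eightyNine :
    ∃ χ : DirichletCharacter ℂ 89, ¬ WeilPositivityOnChar χ (Real.log 8 / 2) :=
  ⟨1, not_weilPositivityOnChar_log8half_principal_of_prime_le (by norm_num) (by norm_num)⟩

/-! ## §6 All moduli: the decision outside `U₈ = {38, 40, 45, 51, 85, 91, 95}` -/

set_option maxRecDepth 100000 in
/-- The floor dispatch below `97`: every modulus outside `F₈ ∪ U₈` is `< 2` or caught by a typed divisibility floor of
the window `(log 8)/2` (`6 ∣ q ≥ 24`, `2 ∣ q ≥ 42`, `3 ∣ q ≥ 54`). [folklore] -/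
theorem principalFloorsLog8_dispatch : ∀ n < 97,
    n ∈ ({2, 3, 4, 5, 6, 7, 8, 9, 10, 11, 12, 13, 14, 15, 16, 17, 18, 19, 20, 21, 22, 23, 25, 26, 27, 28, 29, 31, 32, 33,
      34, 35, 37, 39, 41, 43, 47, 49, 53, 55, 59, 61, 65, 67, 71, 73, 77, 79, 83, 89} : Finset ℕ) ∨
    n ∈ ({38, 40, 45, 51, 85, 91, 95} : Finset ℕ) ∨
    n < 2 ∨ (6 ∣ n ∧ 24 ≤ n) ∨ (2 ∣ n ∧ 42 ≤ n) ∨ (3 ∣ n ∧ 54 ≤ n) := by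
  decide +kernel

/-- ★ **Positive side, all moduli.**  Every Dirichlet character of every modulus `q ≥ 2` outside `F₈ ∪ U₈` is
Weil-positive on `[-(log 8)/2, (log 8)/2]` (uniform floor `97` and the level-`2`/`3`/`6` floors `42`/`54`/`24`).
[cite: Weil1952FormulesExplicites, (11) pp. 261–262 and the «lemme» p. 262] -/
theorem weilPositivityOnChar_log8half_of_not_mem (hq2 : 2 ≤ q)
    (hF : q ∉ ({2, 3, 4, 5, 6, 7, 8, 9, 10, 11, 12, 13, 14, 15, 16, 17, 18, 19, 20, 21, 22, 23, 25, 26, 27, 28, 29, 31, 32,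
      33, 34, 35, 37, 39, 41, 43, 47, 49, 53, 55, 59, 61, 65, 67, 71, 73, 77, 79, 83, 89} : Finset ℕ))
    (hU : q ∉ ({38, 40, 45, 51, 85, 91, 95} : Finset ℕ)) (χ : DirichletCharacter ℂ q) :
    WeilPositivityOnChar χ (Real.log 8 / 2) := by
  by_cases h97 : 97 ≤ q
  · exact weilPositivityOnChar_log8half_of_ge_97 h97 χ
  · rcases principalFloorsLog8_dispatch q (by omega) with h | h | h | ⟨hd, hle⟩ | ⟨hd, hle⟩ | ⟨hd, hle⟩
    · exact absurd h hF
    · exact absurd h hU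
    · omega
    · exact weilPositivityOnChar_log8half_of_six_dvd_ge_24 hd hle χ
    · exact weilPositivityOnChar_log8half_of_two_dvd_ge_42 hd hle χ
    · exact weilPositivityOnChar_log8half_of_three_dvd_ge_54 hd hle χ

/-- ★★★ **ALL MODULI at `(log 8)/2`, modulo seven.**  For every `q ≥ 2` outside `U₈ = {38, 40, 45, 51, 85, 91, 95}`:
every Dirichlet character mod `q` is Weil-positive on `[-(log 8)/2, (log 8)/2]` iff `q ∉ F₈`; on `F₈` the failing
character is the principal one. [cite: Weil1952FormulesExplicites, (11) pp. 261–262 and the «lemme» p. 262] -/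
theorem forall_weilPositivityOnChar_log8half_iff (hq2 : 2 ≤ q) (hU : q ∉ ({38, 40, 45, 51, 85, 91, 95} : Finset ℕ)) :
    (∀ χ : DirichletCharacter ℂ q, WeilPositivityOnChar χ (Real.log 8 / 2)) ↔
      q ∉ ({2, 3, 4, 5, 6, 7, 8, 9, 10, 11, 12, 13, 14, 15, 16, 17, 18, 19, 20, 21, 22, 23, 25, 26, 27, 28, 29, 31, 32,
        33, 34, 35, 37, 39, 41, 43, 47, 49, 53, 55, 59, 61, 65, 67, 71, 73, 77, 79, 83, 89} : Finset ℕ) :=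
  ⟨fun h hF ↦ not_weilPositivityOnChar_log8half_principal hF (h 1),
    fun hF χ ↦ weilPositivityOnChar_log8half_of_not_mem hq2 hF hU χ⟩

/-- **The seven undecided moduli reduce to their principal character** (gen8's domination theorem): for `q ∈ U₈`,
`U_{(log 8)/2}(q)` holds iff the principal character mod `q` is Weil-positive on `[-(log 8)/2, (log 8)/2]`.
[cite: Weil1952FormulesExplicites, (11) pp. 261–262] -/
theorem forall_weilPositivityOnChar_log8half_iff_principal_of_mem (hU : q ∈ ({38, 40, 45, 51, 85, 91, 95} : Finset ℕ)) :
    (∀ χ : DirichletCharacter ℂ q, WeilPositivityOnChar χ (Real.log 8 / 2)) ↔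
      WeilPositivityOnChar (1 : DirichletCharacter ℂ q) (Real.log 8 / 2) := by
  have hq1 : q ≠ 1 := by
    rintro rfl
    simp only [Finset.mem_insert, Finset.mem_singleton] at hU
    omega
  have ha : (0 : ℝ) < Real.log 8 / 2 := by
    have : (1 : ℝ) < 8 := by norm_num
    positivity
  exact forall_weilPositivityOnChar_iff_principal hq1 ha

/-- **The largest failing modulus is `89`**: for every `q ≥ 90` other than the two undecided moduli `91`, `95`, all
characters mod `q` are Weil-positive on `[-(log 8)/2, (log 8)/2]`.
[cite: Weil1952FormulesExplicites, (11) pp. 261–262 and the «lemme» p. 262] -/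
theorem weilPositivityOnChar_log8half_of_ge_90 (hq : 90 ≤ q) (h91 : q ≠ 91) (h95 : q ≠ 95)
    (χ : DirichletCharacter ℂ q) : WeilPositivityOnChar χ (Real.log 8 / 2) := by
  refine weilPositivityOnChar_log8half_of_not_mem (by omega) (fun h ↦ ?_) (fun h ↦ ?_) χ
  · simp only [Finset.mem_insert, Finset.mem_singleton] at h
    omega
  · simp only [Finset.mem_insert, Finset.mem_singleton] at h
    omega

end UniformFloor

end Summit.Ventures.WeilGRH

end
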